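import Summits.KontsevichZagierPeriods.KontsevichZagierPeriods.Theorems.RootDecompWalshStrataParab4Band
import Summits.KontsevichZagierPeriods.KontsevichZagierPeriods.Theorems.RootDecompWalshStrataBall4Planar

/-!
# The paraboloid specimen, part 2/3: the Dirichlet-polar chart of the 3-ball orthant

Route `RootDecompWalshStrata` (cell decomp-kz, lens 4, gen 11), support toward `QuadricSignKernel`
(item stmt-KontsevichZagierPeriods-25393), slice `d = 4`.  After part 1 the paraboloid cell is
`[B³₊, q(1 − |u|²)]`.  This part: the source domain
`C = {w₀, w₁ ∈ (0,1), w₂ > 0, 1 − w₀² − (w₂(1−w₁))² − (w₂w₁)² > 0}` with the pulled-back integrand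
`q(1 − w₀² − (w₂(1−w₁))² − (w₂w₁)²)·w₂`, and the fibrewise DIRICHLET-POLAR chart
`χ(w) = (w₀, w₂(1 − w₁), w₂w₁)` (polynomial, Jacobian `−w₂`, injective on `{w₂ > 0}`, onto `B³₊`, inverse
`(u₀, u₂/(u₁+u₂), u₁+u₂)`), giving the rule-(2) relation `of_cSrcRep_sub_of_b3WRep_mem_relations q :
[C, …] − [B³₊, q(1 − |u|²)] ∈ KZ.relations`.  0 sorry.  [KontsevichZagier2001 §1.2 rule (2)]
-/

noncomputable section
/-- `(1 − v)² + v² > 0`. [folklore] -/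
private theorem gq_pos (v : ℝ) : 0 < (1 - v) ^ 2 + v ^ 2 := by nlinarith [sq_nonneg (1 - 2 * v)]

open Literature.NumberTheory.Transcendental
open MeasureTheory Set
open MvPolynomial (aeval X C)
open Literature.ModelTheory.ExponentialFields (IsSemialgebraic isSemialgebraic_setOf_eval_pos
  isSemialgebraic_setOf_eval_lt continuous_aeval_real)
open Summit.KontsevichZagierPeriods.RootDecompWalshStrata.WalshSpanProof (isSemialgebraic_cubeSet
  isBounded_cubeSet cellRep cellRep_domain cellRep_integrand)
open Summit.KontsevichZagierPeriods.RootDecompWalshStrata.Ball4 (sqSet isSemialgebraic_sqSet sqSet_subset_Icc half_le_gq)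

namespace Summit.KontsevichZagierPeriods.RootDecompWalshStrata.Parab4

/-! #### The source domain `C` and the source representation -/

/-- The 3-ball polynomial pulled back along `χ`: `1 − w₀² − (w₂(1 − w₁))² − (w₂w₁)²`. -/
def cSrcPoly : MvPolynomial (Fin 3) ℚ := 1 - X 0 ^ 2 - (X 2 * (1 - X 1)) ^ 2 - (X 2 * X 1) ^ 2

/-- Evaluation of the pulled-back polynomial. [definition] -/
@[simp] theorem aeval_cSrcPoly (w : Fin 3 → ℝ) :
    aeval w cSrcPoly = 1 - w 0 ^ 2 - (w 2 * (1 - w 1)) ^ 2 - (w 2 * w 1) ^ 2 := by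
  simp [cSrcPoly]

/-- The source domain `C = {w | (w₀,w₁) ∈ (0,1)², 0 < w₂, cSrcPoly(w) > 0}`. -/
def cSrcSet : Set (Fin 3 → ℝ) :=
  {w | Fin.init w ∈ sqSet ∧ 0 < w (Fin.last 2) ∧ 0 < aeval w cSrcPoly}

/-- Membership in `C`, in coordinates. [definition] -/
theorem mem_cSrcSet {w : Fin 3 → ℝ} :
    w ∈ cSrcSet ↔ (0 < w 0 ∧ w 0 < 1) ∧ (0 < w 1 ∧ w 1 < 1) ∧ 0 < w 2 ∧
      0 < 1 - w 0 ^ 2 - (w 2 * (1 - w 1)) ^ 2 - (w 2 * w 1) ^ 2 := by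
  simp only [cSrcSet, sqSet, mem_setOf_eq, aeval_cSrcPoly, Fin.init]
  exact ⟨fun ⟨hu, h2, hP⟩ => ⟨hu 0, hu 1, h2, hP⟩, fun ⟨h0, h1, h2, hP⟩ =>
    ⟨fun j => by fin_cases j <;> assumption, h2, hP⟩⟩

/-- `C` is `ℚ`-semialgebraic. [BCR1998 §2.1] -/
theorem isSemialgebraic_cSrcSet : IsSemialgebraic ℚ cSrcSet := by
  have h := ((isSemialgebraic_sqSet.setOf_init_mem).inter
    (isSemialgebraic_setOf_eval_pos (X (Fin.last 2) : MvPolynomial (Fin 3) ℚ))).inter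
    (isSemialgebraic_setOf_eval_pos cSrcPoly)
  convert h using 1
  ext w
  simp only [cSrcSet, mem_setOf_eq, mem_inter_iff, MvPolynomial.aeval_X, and_assoc]

/-- `C ⊆ [0,2]³` (`w₂ = w₂(1 − w₁) + w₂w₁ < 2`). [folklore] -/
theorem cSrcSet_subset_Icc : cSrcSet ⊆ Icc 0 2 := by
  intro w hw
  rw [mem_cSrcSet] at hw
  obtain ⟨h0, h1, h2, hP⟩ := hw
  have ha : w 2 * (1 - w 1) < 1 := by
    have hpos : 0 < w 2 * (1 - w 1) := mul_pos h2 (by linarith [h1.2])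
    nlinarith [sq_nonneg (w 2 * w 1), sq_nonneg (w 0)]
  have hb : w 2 * w 1 < 1 := by
    have hpos : 0 < w 2 * w 1 := mul_pos h2 h1.1
    nlinarith [sq_nonneg (w 2 * (1 - w 1)), sq_nonneg (w 0)]
  have h2' : w 2 < 2 := by nlinarith
  refine ⟨fun j => ?_, fun j => ?_⟩
  · fin_cases j
    · exact h0.1.le
    · exact h1.1.le
    · exact h2.le
  · fin_cases j
    · simpa using (h0.2.trans one_lt_two).le
    · simpa using (h1.2.trans one_lt_two).le
    · simpa using h2'.le

/-- The pulled-back integrand `q(1 − w₀² − (w₂(1−w₁))² − (w₂w₁)²)·w₂` is continuous on `ℝ³`.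
[folklore] -/
theorem continuous_cSrcInt (q : ℚ) : Continuous fun w : Fin 3 → ℝ =>
    (q : ℝ) * (1 - w 0 ^ 2 - (w 2 * (1 - w 1)) ^ 2 - (w 2 * w 1) ^ 2) * w 2 :=
  (continuous_const.mul (((continuous_const.sub ((continuous_apply 0).pow 2)).sub
    (((continuous_apply 2).mul (continuous_const.sub (continuous_apply 1))).pow 2)).sub
    (((continuous_apply 2).mul (continuous_apply 1)).pow 2))).mul (continuous_apply 2)

/-- `[C, q(1 − w₀² − (w₂(1−w₁))² − (w₂w₁)²)·w₂]`: the source representation of the chart.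
[KontsevichZagier2001 §1.1] -/
def cSrcRep (q : ℚ) : KZ.IntegralRep 3 where
  domain := cSrcSet
  integrand w := (q : ℝ) * (1 - w 0 ^ 2 - (w 2 * (1 - w 1)) ^ 2 - (w 2 * w 1) ^ 2) * w 2
  isSemialgebraic_domain := isSemialgebraic_cSrcSet
  isSemialgebraicFunOn_integrand :=
    (isSemialgebraicFunOn_aeval isSemialgebraic_cSrcSet
      (C q * (1 - X 0 ^ 2 - (X 2 * (1 - X 1)) ^ 2 - (X 2 * X 1) ^ 2) * X 2)).congr fun w _ => by simp
  integrableOn :=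
    ((continuous_cSrcInt q).continuousOn.integrableOn_compact isCompact_Icc).mono_set
      cSrcSet_subset_Icc

/-- The domain of the source representation. [definition] -/
@[simp] theorem cSrcRep_domain (q : ℚ) : (cSrcRep q).domain = cSrcSet := rfl

/-- The integrand of the source representation. [definition] -/
@[simp] theorem cSrcRep_integrand (q : ℚ) (w : Fin 3 → ℝ) :
    (cSrcRep q).integrand w = (q : ℝ) * (1 - w 0 ^ 2 - (w 2 * (1 - w 1)) ^ 2 - (w 2 * w 1) ^ 2) * w 2 :=
  rfl

/-! #### The Dirichlet-polar chart `χ(w) = (w₀, w₂(1 − w₁), w₂w₁)` -/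

/-- The chart as a polynomial map. -/
def chiPoly : Fin 3 → MvPolynomial (Fin 3) ℚ := ![X 0, X 2 * (1 - X 1), X 2 * X 1]

/-- `χ(w) = (w₀, w₂(1 − w₁), w₂w₁)`. -/
def chi : (Fin 3 → ℝ) → (Fin 3 → ℝ) := fun w j => aeval w (chiPoly j)

/-- `χ(w)₀ = w₀`. [definition] -/
@[simp] theorem chi_zero (w : Fin 3 → ℝ) : chi w 0 = w 0 := by simp [chi, chiPoly]

/-- `χ(w)₁ = w₂(1 − w₁)`. [definition] -/
@[simp] theorem chi_one (w : Fin 3 → ℝ) : chi w 1 = w 2 * (1 - w 1) := by simp [chi, chiPoly]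

/-- `χ(w)₂ = w₂w₁`. [definition] -/
@[simp] theorem chi_two (w : Fin 3 → ℝ) : chi w 2 = w 2 * w 1 := by simp [chi, chiPoly]

/-- The Jacobian matrix of `χ`. -/
def chiMat (w : Fin 3 → ℝ) : Matrix (Fin 3) (Fin 3) ℝ :=
  !![1, 0, 0; 0, -(w 2), 1 - w 1; 0, w 2, w 1]

/-- The derivative of `χ` as a continuous linear map. -/
def chi' (w : Fin 3 → ℝ) : (Fin 3 → ℝ) →L[ℝ] (Fin 3 → ℝ) :=
  LinearMap.toContinuousLinearMap (Matrix.toLin' (chiMat w))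

/-- `χ'(w)` acts by the Jacobian matrix. [calculus] -/
theorem chi'_apply (w v : Fin 3 → ℝ) (a : Fin 3) : chi' w v a = ∑ b, chiMat w a b * v b := by
  change Matrix.toLin' (chiMat w) v a = _
  rw [Matrix.toLin'_apply]
  rfl

/-- `det χ'(w) = −w₂`. [calculus] -/
theorem chi'_det (w : Fin 3 → ℝ) : (chi' w).det = -(w 2) := by
  change LinearMap.det (Matrix.toLin' (chiMat w)) = _
  rw [LinearMap.det_toLin', chiMat, Matrix.det_fin_three]
  simp
  ring

/-- `χ` is differentiable with derivative `χ'`. [calculus] -/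
theorem hasFDerivAt_chi (w : Fin 3 → ℝ) : HasFDerivAt chi (chi' w) w := by
  have h0 : HasFDerivAt (fun z : Fin 3 → ℝ => chi z 0)
      ((ContinuousLinearMap.proj 0).comp (chi' w)) w := by
    have hf : (fun z : Fin 3 → ℝ => chi z 0) = fun z => z 0 := funext chi_zero
    rw [hf]
    refine (hasFDerivAt_apply 0 w).congr_fderiv (ContinuousLinearMap.ext fun v => ?_)
    simp [chi'_apply, chiMat, Fin.sum_univ_three]
  have h1 : HasFDerivAt (fun z : Fin 3 → ℝ => chi z 1)
      ((ContinuousLinearMap.proj 1).comp (chi' w)) w := by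
    have hf : (fun z : Fin 3 → ℝ => chi z 1) = fun z => z 2 * (1 - z 1) := funext chi_one
    rw [hf]
    refine ((hasFDerivAt_apply 2 w).mul ((hasFDerivAt_apply 1 w).const_sub 1)).congr_fderiv
      (ContinuousLinearMap.ext fun v => ?_)
    simp [chi'_apply, chiMat, Fin.sum_univ_three]
  have h2 : HasFDerivAt (fun z : Fin 3 → ℝ => chi z 2)
      ((ContinuousLinearMap.proj 2).comp (chi' w)) w := by
    have hf : (fun z : Fin 3 → ℝ => chi z 2) = fun z => z 2 * z 1 := funext chi_two
    rw [hf]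
    refine ((hasFDerivAt_apply 2 w).mul (hasFDerivAt_apply 1 w)).congr_fderiv
      (ContinuousLinearMap.ext fun v => ?_)
    simp [chi'_apply, chiMat, Fin.sum_univ_three]
  refine hasFDerivAt_pi'' fun a => ?_
  fin_cases a
  · exact h0
  · exact h1
  · exact h2

/-- `χ` is injective where `w₂ > 0`. [calculus] -/
theorem injOn_chi : InjOn chi {w | 0 < w 2} := by
  intro x hx y _ hxy
  have e0 : x 0 = y 0 := by simpa using congrFun hxy 0
  have e1 : x 2 * (1 - x 1) = y 2 * (1 - y 1) := by simpa using congrFun hxy 1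
  have e2 : x 2 * x 1 = y 2 * y 1 := by simpa using congrFun hxy 2
  have h2 : x 2 = y 2 := by linear_combination e1 + e2
  have h1 : x 1 = y 1 := by
    have h : x 2 * x 1 = x 2 * y 1 := by rw [e2, h2]
    exact mul_left_cancel₀ (ne_of_gt hx) h
  funext a
  fin_cases a
  · exact e0
  · exact h1
  · exact h2

/-- `χ` maps `C` onto `B³₊` (inverse `w = (u₀, u₂/(u₁+u₂), u₁+u₂)`). [calculus] -/
theorem image_chi : chi '' cSrcSet = b3Set := by
  ext u
  simp only [mem_image, b3Set, mem_setOf_eq, aeval_ball3Poly]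
  constructor
  · rintro ⟨w, hw, rfl⟩
    rw [mem_cSrcSet] at hw
    obtain ⟨h0, h1, h2, hP⟩ := hw
    have ha0 : 0 < w 2 * (1 - w 1) := mul_pos h2 (by linarith [h1.2])
    have hb0 : 0 < w 2 * w 1 := mul_pos h2 h1.1
    have ha : w 2 * (1 - w 1) < 1 := by nlinarith [sq_nonneg (w 2 * w 1), sq_nonneg (w 0)]
    have hb : w 2 * w 1 < 1 := by nlinarith [sq_nonneg (w 2 * (1 - w 1)), sq_nonneg (w 0)]
    refine ⟨fun j => ?_, by simpa using hP⟩
    fin_cases j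
    · simpa using h0
    · simpa using ⟨ha0, ha⟩
    · simpa using ⟨hb0, hb⟩
  · rintro ⟨hu, hP⟩
    have hu0 := hu 0
    have hu1 := hu 1
    have hu2 := hu 2
    have hs : 0 < u 1 + u 2 := add_pos hu1.1 hu2.1
    have hne : u 1 + u 2 ≠ 0 := hs.ne'
    refine ⟨![u 0, u 2 / (u 1 + u 2), u 1 + u 2], ?_, ?_⟩
    · rw [mem_cSrcSet]
      simp only [Matrix.cons_val_zero, Matrix.cons_val_one, Matrix.cons_val]
      refine ⟨hu0, ⟨div_pos hu2.1 hs, (div_lt_one hs).2 (by linarith [hu1.1])⟩, hs, ?_⟩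
      have e1 : (u 1 + u 2) * (1 - u 2 / (u 1 + u 2)) = u 1 := by field_simp; ring
      have e2 : (u 1 + u 2) * (u 2 / (u 1 + u 2)) = u 2 := by field_simp
      rw [e1, e2]
      linarith
    · funext a
      fin_cases a
      · simp
      · simp only [Fin.reduceFinMk, chi_one, Matrix.cons_val]
        field_simp
        ring
      · simp only [Fin.reduceFinMk, chi_two, Matrix.cons_val]
        field_simp

/-- **Move (2), Dirichlet-polar chart:** `[C, …] − [B³₊, q(1 − |u|²)] ∈ KZ.relations` (`|det χ'| = w₂`).
[KontsevichZagier2001 §1.2 rule (2)] -/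
theorem of_cSrcRep_sub_of_b3WRep_mem_relations (q : ℚ) :
    KZ.of (cSrcRep q) - KZ.of (b3WRep q) ∈ KZ.relations := by
  refine KZ.changeOfVariablesRel_subset_relations
    ⟨3, cSrcRep q, b3WRep q, chi, chi', ?_,
      fun w _ => (hasFDerivAt_chi w).hasFDerivWithinAt,
      injOn_chi.mono fun w hw => (mem_cSrcSet.1 hw).2.2.1, ?_, fun w hw => ?_, rfl⟩
  · exact isSemialgebraicMapOn_aeval (cSrcRep q).isSemialgebraic_domain chiPoly
  · rw [b3WRep_domain, cSrcRep_domain, image_chi]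
  · have h2 : 0 < w 2 := (mem_cSrcSet.1 hw).2.2.1
    rw [cSrcRep_integrand, b3WRep_integrand, chi'_det, abs_neg, abs_of_pos h2, chi_zero, chi_one,
      chi_two]

end Summit.KontsevichZagierPeriods.RootDecompWalshStrata.Parab4

end
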